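import Mathlib
import Literature.MathematicalPhysics.QuantumFieldTheory.Balaban1983to89.TreeLength
import Literature.MathematicalPhysics.QuantumFieldTheory.Balaban1983to89.B13Bound143OneShot

/-!
# `Balaban1983to89.B13DiameterG6` — the geometric input G6 behind (2.19) of B13 p. 16: two points of a
# face-connected union Y of N closed cubes of side M are at distance ≤ M·N (sup metric) and ≤ M·(N − 1 + d) ≤ d·M·N
# (ℓ¹ ⊇ Euclidean metric); the hypothesis `hG6 : dist ≤ 4·M·(M⁻⁴|Y|)` of `B13Bound143OneShot` §4 DISCHARGED in d = 4
# for all three metrics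

CITATION HEADER (lean-in-tree rule 2026-08-18).  T. Bałaban, *Renormalization group approach to lattice gauge field
theories. II. Cluster expansions*, Commun. Math. Phys. **116**, 1–22 (1988), doi:10.1007/bf01239022
[Balaban1988RG2Cluster] (cell paper B13; held `paper:balaban1988-cmp116-rg-ii-cluster`, journal page = PDF page), and,
for the notion of a localization domain, T. Bałaban, *Renormalization group approach to lattice gauge field theories.
I. Generation of effective actions in a small field approximation and a coupling constant renormalization in four
dimensions*, Commun. Math. Phys. **109**, 249–301 (1987) [Balaban1987RG1] (cell paper B12), p. 257.  The display (2.19)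
and the sentences around it quoted below were compared with the render `b2b-balaban-ref1/pages/
1988-cmp116-rg-II-cluster/1988-cmp116-rg-II-cluster-p016-x2.png` READ AS AN IMAGE (2026-08-19), not from the OCR
layer.  The paper is UNDER ADJUDICATION by the audit cell `pub-balaban`; nothing of it is asserted here.  What is
proved below is ELEMENTARY COMBINATORIAL GEOMETRY of ℤ^d and ℝ^d, proved by the kernel from Mathlib (finite sums,
`SimpleGraph` walks and paths, the sup metric of `Fin d → ℝ`, `Real.sqrt`); the face adjacency `B13ScaleTransfer.Adj`,
the chain connectedness `B13ScaleTransfer.Linked` / `B13ScaleTransfer.FaceConnected` (unit pv10) and the continuum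
conventions `TreeLength.RPt`, `TreeLength.cube`, `TreeLength.mem_cube` (unit pv22) are used BY NAME, and so are
`B13Bound143.invTau`, `B13Bound143.elem219`, `B13Bound143.rhs143`, `B13Bound143.R12`,
`B13Bound143.tau_mul_le_elem219`, `B13Bound143.elem219_of_bound143` of `…Balaban1983to89.B13Bound143OneShot` (this
lineage, gen 23) and the records `B13.Consts`, `B13.StepData`, `B13.Bound143` of `…Balaban1983to89.B13` (unit r2/b13).
This module is a NEW LEAF: it imports `TreeLength` and `B13Bound143OneShot` and modifies nothing.  Unit
`b2b-balaban-b13-g25` (paper sub-cell B13, gen 25); cell records GAPS C-B13-55 (this leaf), C-B13-54 (owner-side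
reading of the adversarial rows C-adv7-171 / 173 / 174), C-B13-35 UPDATE-7 (census CENSUS-B13-v2 v2.7: geometric
input G6, class P → K), DIVERGENCE D-b13.34 (the modelling conventions stated below).

WHAT IS PRINTED (verbatim).
* [Balaban1988RG2Cluster] p. 16: *"We assume that ⅛(κ₁ − 1) ≧ (1 − 3δ)κ, C₃ ≦ E₀C₁, and q ≧ 8. The quadratic form in
  (1.42), after multiplication by |τ(Y)|, can be bounded by
  ½ Σ_{b,b′⊂Y} α₄M⁻⁴exp(−¼(κ₁ − 1)M⁻⁴|Y| − (1/16)(κ₁ − 1)M⁻¹|b₋ − b′₋|)|B(b)||B(b′)|. (2.19)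
  The sum of these quadratic forms over Y∈𝐃 is bounded by a quadratic form with the above matrix elements resummed
  over all Y∈𝐃_k containing, for example, the point b₋. We use the first exponential factor in (2.19) to bound the
  sum, and this yields a constant O(1). In fact the constant is small for κ₁ large, hence we can bound it by 1."*
  No argument for (2.19) is printed.  The cell's transcript (CHECK of p. 16) derives it from (1.43) × |τ(Y)|
  factorwise — a kernel fact since gen 23, `B13Bound143.rhs143_le_invTau_mul_elem219` — at the price of ONE geometric
  input, census row G6: for bonds b, b′ ⊂ Y the printed second exponent is affordable iff
  (1/16)(κ₁ − 1)M⁻¹|b₋ − b′₋| ≤ ¼(κ₁ − 1)M⁻⁴|Y|, i.e. **|b₋ − b′₋| ≤ 4M · (M⁻⁴|Y|)** = 4M × (the number N of cubes of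
  π_k in Y): *"the diameter of a face-connected union of N M-cubes is ≤ c·N·M; c = 4 fine for Euclidean/ℓ¹ up to the
  norm convention"* (census CENSUS-B13-v2 §4 row G6, class P = checked on paper only).  It entered
  `B13Bound143OneShot` §4 as the real hypothesis `hG6 : dist ≤ 4 * c.M * n`.
* [Balaban1987RG1] p. 257 (the domains Y ∈ 𝐃_k): *"We decompose the space T into the lattice of closed cubes of a
  size M … we rescale the space, so that cubes from π_j become unit cubes … A connected family means that for every
  pair □, □′ of cubes from the family there exists a sequence □, □₁, …, □_n, □′ of cubes belonging to the family and
  such that two consecutive cubes have a common wall, i.e. their intersection is a d−1-dimensional cube"* (typed as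
  `B13ScaleTransfer.FaceConnected`: cubes indexed by x ∈ ℤ^d, a common wall meaning y = x ± e_i,
  `B13ScaleTransfer.Adj`).  The norm |·| on points is named neither in [I] nor in [II] (cell DIVERGENCE D-T2); all
  three candidates (sup, ℓ¹, Euclidean) are treated below.

WHAT THIS FILE CERTIFIES (zero `sorry`; d arbitrary unless stated; N = #Y ≥ 1 as soon as Y has a cube).
* §1 LATTICE SIDE.  `l1` (the ℓ¹ distance Σ_i |x_i − y_i| of cube indices) with `l1_self`, `l1_nonneg`, `l1_comm`,
  `l1_triangle`, `abs_sub_le_l1`, `l1_update_add_one`, `l1_of_adj` (a common wall ⇒ ℓ¹ distance exactly 1),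
  `adj_ne`; `faceGraph Y` (the `SimpleGraph` on the cubes of Y whose edges are the common walls), `faceGraph_adj`,
  `reachable_of_linked` (a chain of [I] p. 257 is a walk), `l1_le_length` (a walk of length n joins indices at ℓ¹
  distance ≤ n), and THE COUNT `l1_le_card_sub_one`: in a face-connected family Y of N cubes any two cube indices
  satisfy **Σ_i |x_i − y_i| ≤ N − 1** (shorten the chain to a path, `SimpleGraph.Walk.bypass`; a path visits at most N
  cubes, `SimpleGraph.Walk.IsPath.length_lt`); `abs_sub_le_card_sub_one` (each coordinate differs by ≤ N − 1).
* §2 CONTINUUM SIDE.  `cubeM M x` = the closed cube [Mx, M(x + 1)]^d of side M and index x (`mem_cubeM`; `cubeM_one`: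
  at M = 1 it is `TreeLength.cube x`; `corner_mem_cubeM`, `farCorner_mem_cubeM`); for P ∈ cubeM M x, Q ∈ cubeM M y
  with x, y in a face-connected Y and M ≥ 0: `abs_sub_le_of_mem_cubeM` (|P_i − Q_i| ≤ M(|x_i − y_i| + 1)),
  `sup_dist_le` (**dist P Q ≤ M·N**, Mathlib's sup metric on `Fin d → ℝ`), `l1_dist_le` (**Σ_i |P_i − Q_i| ≤
  M(N − 1 + d)**), `l1_dist_le_dim_mul` (≤ d·M·N for d ≥ 1), `sum_sq_le_sq_sum`, `l2_dist_le_l1`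
  (**√Σ_i (P_i − Q_i)² ≤ Σ_i |P_i − Q_i|**); and the attained case `l1_dist_single_cube` (one cube, opposite corners:
  ℓ¹ distance exactly d·M = M(N − 1 + d) at N = 1 — so the constant d of `l1_dist_le_dim_mul`, = the census' 4 in
  d = 4, cannot be lowered in the ℓ¹ reading).
* §3 d = 4: `G6_sup`, `G6_l1`, `G6_l2` — each of the three distances is ≤ 4·M·N, literally the shape of `hG6`.
* §4 THE DISCHARGE.  `elem219_antitone_dist` (the matrix element of (2.19) is antitone in the distance datum for
  κ₁ ≥ 1, M > 0, α₄ ≥ 0 — a bound stated with a larger distance convention implies the one with a smaller);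
  `tau_mul_le_elem219_sup` / `_l1` / `_l2`: the gen-23 theorem `B13Bound143.tau_mul_le_elem219` ((1.43) × |τ(Y)| ≤ the
  matrix element of (2.19), under R12, κ₁ ≥ 1, M ≥ 1, E₀, ε₁, C₁, α₄ > 0, C₃ ≥ 0, d_k(Y) ≥ 0) with its hypothesis `hG6`
  REPLACED by: Y a face-connected finite family of cube indices in ℤ⁴, b₋ = P ∈ cubeM M x, b′₋ = Q ∈ cubeM M y,
  x, y ∈ Y, n = #Y; `elem219_of_bound143_sup` / `_l1` / `_l2`: the same from the statement of record `B13.Bound143 S c`,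
  for every domain Y of the abstract step data whose cube count `S.volk Y` is the cardinal of a face-connected index
  family carrying the two points.

WHAT IS *NOT* REPRODUCED OR ASSERTED.  (2.19) as a bound on the whole quadratic form of (1.42) (only its matrix element
versus (1.43) × |τ(Y)|, as in gen 23); the resummation (2.20) over Y ∋ b₋ with (1.26) / (1.28) (census §2 row 16 stays
P for that part: it needs the count of connected cube families behind (1.26), by reference to [I]); any
identification of Bałaban's bonds or of the unit lattice inside the cubes of π_k (the lattice points of a cube of π_k
lie in the closed cube `cubeM M x` — the only fact the discharge uses), or of the norm |·| (D-T2: sup, ℓ¹ and ℓ² are all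
covered, with M·N ≤ M(N + 3) ≤ 4M·N in d = 4); anything about the series.  MODELLING (DIVERGENCE D-b13.34): Y ↦ a
`Finset (Fin 4 → ℤ)` of cube indices with `FaceConnected`; M⁻⁴|Y| ↦ its cardinal (`S.volk Y = I.card` in the
abstract-carrier corollaries); b₋, b′₋ ↦ points of `cubeM c.M x`, `cubeM c.M y`, x, y ∈ Y.  Value = one census input
(G6) turned from "checked on paper" into a kernel fact, and a real hypothesis of a standing tree theorem discharged —
located-gap bookkeeping, NOT summit progress.
-/

namespace Literature.MathematicalPhysics.QuantumFieldTheory.Balaban1983to89.B13DiameterG6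

noncomputable section

open Literature.MathematicalPhysics.QuantumFieldTheory.Balaban1983to89
open Literature.MathematicalPhysics.QuantumFieldTheory.Balaban1983to89.B13ScaleTransfer
open Literature.MathematicalPhysics.QuantumFieldTheory.Balaban1983to89.TreeLength
open Literature.MathematicalPhysics.QuantumFieldTheory.Balaban1983to89.B13Bound143

variable {d : ℕ}

/-! ## §1 The lattice side: the ℓ¹ distance of cube indices along a chain of common walls -/

/-- The ℓ¹ distance `Σ_i |x_i − y_i|` of two cube indices x, y ∈ ℤ^d. [folklore] -/
def l1 (x y : Pt d) : ℤ := ∑ i, |x i - y i|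

/-- `l1 x x = 0`. [folklore] -/
theorem l1_self (x : Pt d) : l1 x x = 0 := by
  simp [l1]

/-- `l1 x y ≥ 0`. [folklore] -/
theorem l1_nonneg (x y : Pt d) : 0 ≤ l1 x y :=
  Finset.sum_nonneg fun i _ => abs_nonneg (x i - y i)

/-- `l1` is symmetric. [folklore] -/
theorem l1_comm (x y : Pt d) : l1 x y = l1 y x := by
  simp only [l1, abs_sub_comm]

/-- The triangle inequality for `l1`. [folklore] -/
theorem l1_triangle (x y z : Pt d) : l1 x z ≤ l1 x y + l1 y z := by
  unfold l1
  rw [← Finset.sum_add_distrib]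
  exact Finset.sum_le_sum fun i _ => abs_sub_le (x i) (y i) (z i)

/-- One coordinate difference is at most the ℓ¹ distance. [folklore] -/
theorem abs_sub_le_l1 (x y : Pt d) (i : Fin d) : |x i - y i| ≤ l1 x y :=
  Finset.single_le_sum (f := fun j => |x j - y j|) (fun _ _ => abs_nonneg _) (Finset.mem_univ i)

/-- The cube x + e_i is at ℓ¹ distance exactly 1 from the cube x. [folklore] -/
theorem l1_update_add_one (x : Pt d) (i : Fin d) : l1 x (Function.update x i (x i + 1)) = 1 := by
  unfold l1
  rw [Finset.sum_eq_single i]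
  · simp
  · intro j _ hj
    simp [Function.update_of_ne hj]
  · intro h
    exact absurd (Finset.mem_univ i) h

/-- Cubes with a common wall ([Balaban1987RG1] p. 257: indices y = x ± e_i) have indices at ℓ¹ distance exactly 1.
[cite: Balaban1987RG1, p.257 (localization domains)] -/
theorem l1_of_adj {x y : Pt d} (h : Adj x y) : l1 x y = 1 := by
  obtain ⟨i, h | h⟩ := h
  · subst h
    exact l1_update_add_one x i
  · subst h
    rw [l1_comm]
    exact l1_update_add_one y i

/-- Cubes with a common wall are different cubes. [folklore] -/
theorem adj_ne {x y : Pt d} (h : Adj x y) : x ≠ y := by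
  rintro rfl
  have h1 := l1_of_adj h
  rw [l1_self] at h1
  exact zero_ne_one h1

/-- The graph on the cubes of a family Y ⊂ ℤ^d whose edges are the common walls ([Balaban1987RG1] p. 257: *"two
consecutive cubes have a common wall"*). [cite: Balaban1987RG1, p.257 (localization domains)] -/
def faceGraph (Y : Finset (Pt d)) : SimpleGraph ↥Y where
  Adj a b := B13ScaleTransfer.Adj a.1 b.1
  symm := ⟨fun _ _ h => B13ScaleTransfer.Adj.symm h⟩
  loopless := ⟨fun _ h => adj_ne h rfl⟩

/-- Adjacency in `faceGraph Y`, unfolded. [folklore] -/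
theorem faceGraph_adj {Y : Finset (Pt d)} {a b : ↥Y} : (faceGraph Y).Adj a b ↔ B13ScaleTransfer.Adj a.1 b.1 :=
  Iff.rfl

/-- A chain of cubes of Y with consecutive common walls ([Balaban1987RG1] p. 257) from x to y is a walk of
`faceGraph Y`: chain-connected cubes are reachable. [cite: Balaban1987RG1, p.257 (localization domains)] -/
theorem reachable_of_linked {Y : Finset (Pt d)} {x y : Pt d} (h : Linked Y x y) (hx : x ∈ Y) :
    ∀ hy : y ∈ Y, (faceGraph Y).Reachable ⟨x, hx⟩ ⟨y, hy⟩ := by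
  unfold Linked at h
  induction h with
  | refl =>
    intro hy
    exact SimpleGraph.Reachable.refl _
  | tail _ hbc ih =>
    intro hy
    exact (ih hbc.1).trans (SimpleGraph.Adj.reachable (faceGraph_adj.2 hbc.2.2))

/-- A walk of length n in `faceGraph Y` joins cube indices at ℓ¹ distance ≤ n. [folklore] -/
theorem l1_le_length {Y : Finset (Pt d)} {u v : ↥Y} (p : (faceGraph Y).Walk u v) :
    l1 u.1 v.1 ≤ (p.length : ℤ) := by
  induction p with
  | nil => simp [l1_self]
  | @cons a b e hadj p ih =>
    rw [SimpleGraph.Walk.length_cons]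
    push_cast
    have h1 : l1 a.1 b.1 = 1 := l1_of_adj (faceGraph_adj.1 hadj)
    have h2 := l1_triangle a.1 b.1 e.1
    linarith

/-- **The count.**  In a face-connected family Y of N cubes ([Balaban1987RG1] p. 257) any two cube indices are at ℓ¹
distance ≤ N − 1: a chain of cubes with consecutive common walls between them can be shortened to a path, which visits
at most N cubes of Y and therefore has at most N − 1 steps, each of ℓ¹ length 1. [cite: Balaban1987RG1, p.257 (localization domains)] -/
theorem l1_le_card_sub_one {Y : Finset (Pt d)} (hY : FaceConnected Y) {x y : Pt d} (hx : x ∈ Y) (hy : y ∈ Y) :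
    l1 x y ≤ (Y.card : ℤ) - 1 := by
  classical
  obtain ⟨p⟩ := reachable_of_linked (hY x hx y hy) hx hy
  have hlt := p.bypass_isPath.length_lt
  rw [Fintype.card_coe] at hlt
  have h1 := l1_le_length p.bypass
  have h2 : (p.bypass.length : ℤ) ≤ (Y.card : ℤ) - 1 := by omega
  exact h1.trans h2

/-- Each coordinate of two cube indices of a face-connected family of N cubes differs by at most N − 1. [cite: Balaban1987RG1, p.257 (localization domains)] -/
theorem abs_sub_le_card_sub_one {Y : Finset (Pt d)} (hY : FaceConnected Y) {x y : Pt d} (hx : x ∈ Y)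
    (hy : y ∈ Y) (i : Fin d) : |x i - y i| ≤ (Y.card : ℤ) - 1 :=
  (abs_sub_le_l1 x y i).trans (l1_le_card_sub_one hY hx hy)

/-! ## §2 The continuum side: closed cubes of side M, the sup, ℓ¹ and Euclidean distances of their points -/

/-- The closed cube [Mx, M(x + 1)]^d of side M and index x ∈ ℤ^d — a cube *"of a size M"* of [Balaban1987RG1] p. 257
before the rescaling to unit cubes. [cite: Balaban1987RG1, p.257 (localization domains)] -/
def cubeM (M : ℝ) (x : Pt d) : Set (RPt d) :=
  {P | ∀ i, M * (x i : ℝ) ≤ P i ∧ P i ≤ M * ((x i : ℝ) + 1)}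

/-- Membership in `cubeM M x`, coordinatewise: M·x_i ≤ P_i ≤ M·(x_i + 1). [folklore] -/
theorem mem_cubeM {M : ℝ} {x : Pt d} {P : RPt d} :
    P ∈ cubeM M x ↔ ∀ i, M * (x i : ℝ) ≤ P i ∧ P i ≤ M * ((x i : ℝ) + 1) :=
  Iff.rfl

/-- At M = 1 the cube of side M is the unit cube `TreeLength.cube x` of [Balaban1987RG1] p. 257 after rescaling.
[cite: Balaban1987RG1, p.257 (localization domains)] -/
theorem cubeM_one (x : Pt d) : cubeM 1 x = cube x := by
  ext P
  rw [mem_cubeM, mem_cube]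
  simp only [one_mul]

/-- The lower corner M·x of the cube of side M ≥ 0 and index x belongs to it. [folklore] -/
theorem corner_mem_cubeM {M : ℝ} (hM : 0 ≤ M) (x : Pt d) : (fun i => M * (x i : ℝ)) ∈ cubeM M x :=
  fun i => ⟨le_rfl, mul_le_mul_of_nonneg_left (by linarith) hM⟩

/-- The upper corner M·(x + 𝟙) of the cube of side M ≥ 0 and index x belongs to it. [folklore] -/
theorem farCorner_mem_cubeM {M : ℝ} (hM : 0 ≤ M) (x : Pt d) : (fun i => M * ((x i : ℝ) + 1)) ∈ cubeM M x :=
  fun i => ⟨mul_le_mul_of_nonneg_left (by linarith) hM, le_rfl⟩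

/-- Coordinatewise: points of the cubes of side M ≥ 0 and indices x, y differ in the i-th coordinate by at most
M·(|x_i − y_i| + 1). [folklore] -/
theorem abs_sub_le_of_mem_cubeM {M : ℝ} (hM : 0 ≤ M) {x y : Pt d} {P Q : RPt d} (hP : P ∈ cubeM M x)
    (hQ : Q ∈ cubeM M y) (i : Fin d) : |P i - Q i| ≤ M * (|(x i : ℝ) - y i| + 1) := by
  obtain ⟨h1, h2⟩ := hP i
  obtain ⟨h3, h4⟩ := hQ i
  have h5 : M * ((x i : ℝ) - y i) ≤ M * |(x i : ℝ) - y i| := mul_le_mul_of_nonneg_left (le_abs_self _) hM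
  have h6 : M * ((y i : ℝ) - x i) ≤ M * |(x i : ℝ) - y i| :=
    mul_le_mul_of_nonneg_left (by rw [abs_sub_comm]; exact le_abs_self _) hM
  rw [abs_sub_le_iff]
  constructor <;> linarith

/-- **G6, sup metric.**  Two points of a face-connected union of N closed cubes of side M ≥ 0 are at sup-distance
≤ M·N (each coordinate: ≤ M·((N − 1) + 1) by `abs_sub_le_card_sub_one`).  This is the geometric input behind the
second exponent of (2.19) p. 16 in the sup-norm reading, with room to spare (M·N ≤ 4M·N). [cite: Balaban1988RG2Cluster, (2.19) p.16] -/
theorem sup_dist_le {M : ℝ} (hM : 0 ≤ M) {Y : Finset (Pt d)} (hY : FaceConnected Y) {x y : Pt d} (hx : x ∈ Y)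
    (hy : y ∈ Y) {P Q : RPt d} (hP : P ∈ cubeM M x) (hQ : Q ∈ cubeM M y) : dist P Q ≤ M * Y.card := by
  rw [dist_pi_le_iff (mul_nonneg hM (Nat.cast_nonneg _))]
  intro i
  rw [Real.dist_eq]
  have h1 := abs_sub_le_of_mem_cubeM hM hP hQ i
  have h2 : |(x i : ℝ) - y i| ≤ (Y.card : ℝ) - 1 := by
    have := abs_sub_le_card_sub_one hY hx hy i
    exact_mod_cast this
  have h3 : M * (|(x i : ℝ) - y i| + 1) ≤ M * Y.card := mul_le_mul_of_nonneg_left (by linarith) hM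
  exact h1.trans h3

/-- **G6, ℓ¹ metric.**  Two points of a face-connected union of N closed cubes of side M ≥ 0 in ℝ^d satisfy
Σ_i |P_i − Q_i| ≤ M·(N − 1 + d) (sum `abs_sub_le_of_mem_cubeM` over i and use `l1_le_card_sub_one`). [cite: Balaban1988RG2Cluster, (2.19) p.16] -/
theorem l1_dist_le {M : ℝ} (hM : 0 ≤ M) {Y : Finset (Pt d)} (hY : FaceConnected Y) {x y : Pt d} (hx : x ∈ Y)
    (hy : y ∈ Y) {P Q : RPt d} (hP : P ∈ cubeM M x) (hQ : Q ∈ cubeM M y) :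
    ∑ i, |P i - Q i| ≤ M * ((Y.card : ℝ) - 1 + d) := by
  have h1 : ∑ i, |P i - Q i| ≤ ∑ i, M * (|(x i : ℝ) - y i| + 1) :=
    Finset.sum_le_sum fun i _ => abs_sub_le_of_mem_cubeM hM hP hQ i
  have h2 : ∑ i, M * (|(x i : ℝ) - y i| + 1) = M * (∑ i, |(x i : ℝ) - y i| + d) := by
    rw [← Finset.mul_sum, Finset.sum_add_distrib]
    simp
  have h3 : ∑ i, |(x i : ℝ) - y i| ≤ (Y.card : ℝ) - 1 := by
    have := l1_le_card_sub_one hY hx hy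
    unfold l1 at this
    exact_mod_cast this
  calc ∑ i, |P i - Q i| ≤ M * (∑ i, |(x i : ℝ) - y i| + d) := h1.trans h2.le
    _ ≤ M * ((Y.card : ℝ) - 1 + d) := mul_le_mul_of_nonneg_left (by linarith) hM

/-- **G6, ℓ¹ metric, census form**: in dimension d ≥ 1 the ℓ¹ distance is ≤ d·M·N (since N ≥ 1:
M(N − 1 + d) ≤ d·M·N ⟺ (d − 1)(N − 1) ≥ 0). [cite: Balaban1988RG2Cluster, (2.19) p.16] -/
theorem l1_dist_le_dim_mul (hd : 1 ≤ d) {M : ℝ} (hM : 0 ≤ M) {Y : Finset (Pt d)} (hY : FaceConnected Y)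
    {x y : Pt d} (hx : x ∈ Y) (hy : y ∈ Y) {P Q : RPt d} (hP : P ∈ cubeM M x) (hQ : Q ∈ cubeM M y) :
    ∑ i, |P i - Q i| ≤ d * M * Y.card := by
  have h1 := l1_dist_le hM hY hx hy hP hQ
  have hd' : (1 : ℝ) ≤ d := by exact_mod_cast hd
  have hc : (1 : ℝ) ≤ Y.card := by exact_mod_cast Finset.card_pos.2 ⟨x, hx⟩
  have h2 : 0 ≤ M * (((d : ℝ) - 1) * ((Y.card : ℝ) - 1)) :=
    mul_nonneg hM (mul_nonneg (by linarith) (by linarith))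
  nlinarith

/-- For nonnegative reals, Σ_i a_i² ≤ (Σ_i a_i)². [folklore] -/
theorem sum_sq_le_sq_sum {ι : Type*} (s : Finset ι) (f : ι → ℝ) :
    (∀ i ∈ s, 0 ≤ f i) → ∑ i ∈ s, f i ^ 2 ≤ (∑ i ∈ s, f i) ^ 2 := by
  classical
  refine Finset.induction_on s (by simp) ?_
  intro a s ha ih hf
  rw [Finset.sum_insert ha, Finset.sum_insert ha]
  have h0 : 0 ≤ f a := hf a (Finset.mem_insert_self a s)
  have hf' : ∀ i ∈ s, 0 ≤ f i := fun i hi => hf i (Finset.mem_insert_of_mem hi)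
  have h1 : 0 ≤ ∑ i ∈ s, f i := Finset.sum_nonneg hf'
  have h2 := ih hf'
  nlinarith [mul_nonneg h0 h1]

/-- The Euclidean distance is at most the ℓ¹ distance: √Σ_i (P_i − Q_i)² ≤ Σ_i |P_i − Q_i|. [folklore] -/
theorem l2_dist_le_l1 (P Q : RPt d) : Real.sqrt (∑ i, (P i - Q i) ^ 2) ≤ ∑ i, |P i - Q i| := by
  rw [Real.sqrt_le_left (Finset.sum_nonneg fun i _ => abs_nonneg _)]
  calc ∑ i, (P i - Q i) ^ 2 = ∑ i, |P i - Q i| ^ 2 := by simp [sq_abs]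
    _ ≤ (∑ i, |P i - Q i|) ^ 2 := sum_sq_le_sq_sum _ _ fun i _ => abs_nonneg _

/-- **G6, Euclidean metric**: √Σ_i (P_i − Q_i)² ≤ M·(N − 1 + d). [cite: Balaban1988RG2Cluster, (2.19) p.16] -/
theorem l2_dist_le {M : ℝ} (hM : 0 ≤ M) {Y : Finset (Pt d)} (hY : FaceConnected Y) {x y : Pt d} (hx : x ∈ Y)
    (hy : y ∈ Y) {P Q : RPt d} (hP : P ∈ cubeM M x) (hQ : Q ∈ cubeM M y) :
    Real.sqrt (∑ i, (P i - Q i) ^ 2) ≤ M * ((Y.card : ℝ) - 1 + d) :=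
  (l2_dist_le_l1 P Q).trans (l1_dist_le hM hY hx hy hP hQ)

/-- **The ℓ¹ constant is attained by one cube.**  The two opposite corners M·x and M·(x + 𝟙) of a single cube of side
M ≥ 0 (both in `cubeM M x`, `corner_mem_cubeM`, `farCorner_mem_cubeM`; `{x}` is face-connected with N = 1 — the
tree's `Beta.RemainderLimitTorus.faceConnected_singleton`, referred to by name) are at ℓ¹
distance exactly d·M = M·(N − 1 + d) = d·M·N: the bounds `l1_dist_le` and `l1_dist_le_dim_mul` are sharp at N = 1, so
the census constant 4 (d = 4) cannot be lowered in the ℓ¹ reading. [folklore] -/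
theorem l1_dist_single_cube {M : ℝ} (hM : 0 ≤ M) (x : Pt d) :
    ∑ i, |M * (x i : ℝ) - M * ((x i : ℝ) + 1)| = d * M := by
  have h : ∀ i : Fin d, |M * (x i : ℝ) - M * ((x i : ℝ) + 1)| = M := fun i => by
    rw [show M * (x i : ℝ) - M * ((x i : ℝ) + 1) = -M by ring, abs_neg, abs_of_nonneg hM]
  simp [h]

/-! ## §3 d = 4: the census form `dist ≤ 4·M·N` in the three metrics -/

/-- **G6 in d = 4, sup metric**: dist P Q ≤ M·N ≤ 4·M·N — the shape of the hypothesis `hG6` of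
`B13Bound143.tau_mul_le_elem219`. [cite: Balaban1988RG2Cluster, (2.19) p.16] -/
theorem G6_sup {M : ℝ} (hM : 0 ≤ M) {Y : Finset (Pt 4)} (hY : FaceConnected Y) {x y : Pt 4} (hx : x ∈ Y)
    (hy : y ∈ Y) {P Q : RPt 4} (hP : P ∈ cubeM M x) (hQ : Q ∈ cubeM M y) : dist P Q ≤ 4 * M * Y.card := by
  have h := sup_dist_le hM hY hx hy hP hQ
  have h0 : 0 ≤ M * Y.card := mul_nonneg hM (Nat.cast_nonneg _)
  linarith

/-- **G6 in d = 4, ℓ¹ metric**: Σ_i |P_i − Q_i| ≤ M(N + 3) ≤ 4·M·N. [cite: Balaban1988RG2Cluster, (2.19) p.16] -/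
theorem G6_l1 {M : ℝ} (hM : 0 ≤ M) {Y : Finset (Pt 4)} (hY : FaceConnected Y) {x y : Pt 4} (hx : x ∈ Y)
    (hy : y ∈ Y) {P Q : RPt 4} (hP : P ∈ cubeM M x) (hQ : Q ∈ cubeM M y) :
    ∑ i, |P i - Q i| ≤ 4 * M * Y.card := by
  simpa using l1_dist_le_dim_mul (d := 4) (by norm_num) hM hY hx hy hP hQ

/-- **G6 in d = 4, Euclidean metric**: √Σ_i (P_i − Q_i)² ≤ 4·M·N. [cite: Balaban1988RG2Cluster, (2.19) p.16] -/
theorem G6_l2 {M : ℝ} (hM : 0 ≤ M) {Y : Finset (Pt 4)} (hY : FaceConnected Y) {x y : Pt 4} (hx : x ∈ Y)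
    (hy : y ∈ Y) {P Q : RPt 4} (hP : P ∈ cubeM M x) (hQ : Q ∈ cubeM M y) :
    Real.sqrt (∑ i, (P i - Q i) ^ 2) ≤ 4 * M * Y.card :=
  (l2_dist_le_l1 P Q).trans (G6_l1 hM hY hx hy hP hQ)

/-! ## §4 The discharge: `B13Bound143.tau_mul_le_elem219` and `elem219_of_bound143` without the hypothesis hG6 -/

/-- The matrix element of (2.19), `B13Bound143.elem219 c n dist = α₄M⁻⁴exp(−¼(κ₁−1)n − (1/16)(κ₁−1)M⁻¹dist)`, is
antitone in the distance datum for κ₁ ≥ 1, M > 0, α₄ ≥ 0: a bound with a larger distance convention implies the one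
with a smaller (e.g. Euclidean ≤ ℓ¹, `l2_dist_le_l1`). [cite: Balaban1988RG2Cluster, (2.19) p.16] -/
theorem elem219_antitone_dist (c : B13.Consts) (hκ₁ : 1 ≤ c.κ₁) (hM : 0 < c.M) (hα : 0 ≤ c.α₄) (n : ℝ)
    {D₁ D₂ : ℝ} (h : D₁ ≤ D₂) : elem219 c n D₂ ≤ elem219 c n D₁ := by
  unfold elem219
  have h1 : c.M⁻¹ * D₁ ≤ c.M⁻¹ * D₂ := mul_le_mul_of_nonneg_left h (inv_nonneg.mpr hM.le)
  have h2 : (c.κ₁ - 1) * (c.M⁻¹ * D₁) ≤ (c.κ₁ - 1) * (c.M⁻¹ * D₂) :=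
    mul_le_mul_of_nonneg_left h1 (by linarith)
  have h3 : 0 ≤ c.α₄ * (c.M ^ 4)⁻¹ := mul_nonneg hα (inv_nonneg.mpr (by positivity))
  exact mul_le_mul_of_nonneg_left (Real.exp_le_exp.mpr (by linarith)) h3

/-- **(1.43) × |τ(Y)| ≤ the matrix element of (2.19) — sup metric, G6 DISCHARGED.**  `B13Bound143.tau_mul_le_elem219`
with its geometric hypothesis `hG6 : dist ≤ 4M·n` replaced by the data it abbreviates: Y a face-connected finite family
of cube indices in ℤ⁴ (a domain from 𝐃_k, [Balaban1987RG1] p. 257), n = #Y = M⁻⁴|Y|, b₋ = P and b′₋ = Q points of the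
closed cubes of side M of indices x, y ∈ Y, the distance |b₋ − b′₋| read in the sup norm. [cite: Balaban1988RG2Cluster, (2.18)–(2.19) p.16] -/
theorem tau_mul_le_elem219_sup (c : B13.Consts) (h12 : R12 c) (hC₃ : 0 ≤ c.C₃) (hE : 0 < c.E₀) (hε : 0 < c.ε₁)
    (hC₁ : 0 < c.C₁) (hα : 0 < c.α₄) (hM : 1 ≤ c.M) (hκ₁ : 1 ≤ c.κ₁) {dk : ℝ} (hd : 0 ≤ dk)
    {Y : Finset (Pt 4)} (hY : FaceConnected Y) {x y : Pt 4} (hx : x ∈ Y) (hy : y ∈ Y) {P Q : RPt 4}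
    (hP : P ∈ cubeM c.M x) (hQ : Q ∈ cubeM c.M y) {Qabs : ℝ} (hQabs : Qabs ≤ rhs143 c dk Y.card) :
    (invTau c dk)⁻¹ * Qabs ≤ elem219 c Y.card (dist P Q) :=
  tau_mul_le_elem219 c h12 hC₃ hE hε hC₁ hα hM hκ₁ hd (G6_sup (by linarith) hY hx hy hP hQ) hQabs

/-- **(1.43) × |τ(Y)| ≤ the matrix element of (2.19) — ℓ¹ metric, G6 DISCHARGED** (as `tau_mul_le_elem219_sup`, the
distance |b₋ − b′₋| read as Σ_i |P_i − Q_i|). [cite: Balaban1988RG2Cluster, (2.18)–(2.19) p.16] -/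
theorem tau_mul_le_elem219_l1 (c : B13.Consts) (h12 : R12 c) (hC₃ : 0 ≤ c.C₃) (hE : 0 < c.E₀) (hε : 0 < c.ε₁)
    (hC₁ : 0 < c.C₁) (hα : 0 < c.α₄) (hM : 1 ≤ c.M) (hκ₁ : 1 ≤ c.κ₁) {dk : ℝ} (hd : 0 ≤ dk)
    {Y : Finset (Pt 4)} (hY : FaceConnected Y) {x y : Pt 4} (hx : x ∈ Y) (hy : y ∈ Y) {P Q : RPt 4}
    (hP : P ∈ cubeM c.M x) (hQ : Q ∈ cubeM c.M y) {Qabs : ℝ} (hQabs : Qabs ≤ rhs143 c dk Y.card) :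
    (invTau c dk)⁻¹ * Qabs ≤ elem219 c Y.card (∑ i, |P i - Q i|) :=
  tau_mul_le_elem219 c h12 hC₃ hE hε hC₁ hα hM hκ₁ hd (G6_l1 (by linarith) hY hx hy hP hQ) hQabs

/-- **(1.43) × |τ(Y)| ≤ the matrix element of (2.19) — Euclidean metric, G6 DISCHARGED** (as `tau_mul_le_elem219_sup`,
the distance |b₋ − b′₋| read as √Σ_i (P_i − Q_i)²). [cite: Balaban1988RG2Cluster, (2.18)–(2.19) p.16] -/
theorem tau_mul_le_elem219_l2 (c : B13.Consts) (h12 : R12 c) (hC₃ : 0 ≤ c.C₃) (hE : 0 < c.E₀) (hε : 0 < c.ε₁)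
    (hC₁ : 0 < c.C₁) (hα : 0 < c.α₄) (hM : 1 ≤ c.M) (hκ₁ : 1 ≤ c.κ₁) {dk : ℝ} (hd : 0 ≤ dk)
    {Y : Finset (Pt 4)} (hY : FaceConnected Y) {x y : Pt 4} (hx : x ∈ Y) (hy : y ∈ Y) {P Q : RPt 4}
    (hP : P ∈ cubeM c.M x) (hQ : Q ∈ cubeM c.M y) {Qabs : ℝ} (hQabs : Qabs ≤ rhs143 c dk Y.card) :
    (invTau c dk)⁻¹ * Qabs ≤ elem219 c Y.card (Real.sqrt (∑ i, (P i - Q i) ^ 2)) :=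
  tau_mul_le_elem219 c h12 hC₃ hE hε hC₁ hα hM hκ₁ hd (G6_l2 (by linarith) hY hx hy hP hQ) hQabs

/-- **From the statement of record, sup metric, G6 DISCHARGED.**  `B13.Bound143 S c` (the typed (1.43)) gives the
(2.19) matrix-element bound after multiplication by |τ(Y)| for every domain Y of the step data whose cube count
`S.volk Y` is the cardinal of a face-connected index family `I ⊂ ℤ⁴` and all b₋ = P, b′₋ = Q in closed cubes of side M
of indices in I (`B13Bound143.elem219_of_bound143` with `hG6` supplied by `G6_sup`). [cite: Balaban1988RG2Cluster, (2.19) p.16, (1.43) p.11] -/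
theorem elem219_of_bound143_sup (S : B13.StepData) (c : B13.Consts) (h143 : B13.Bound143 S c) (h12 : R12 c)
    (hC₃ : 0 ≤ c.C₃) (hE : 0 < c.E₀) (hε : 0 < c.ε₁) (hC₁ : 0 < c.C₁) (hα : 0 < c.α₄) (hM : 1 ≤ c.M)
    (hκ₁ : 1 ≤ c.κ₁) (Y : S.Dk.Dom) (φ : S.Φ) (b b' : S.Bond) (hφ : φ ∈ S.sp1 Y)
    {I : Finset (Pt 4)} (hI : FaceConnected I) (hvol : S.volk Y = I.card) {x y : Pt 4} (hx : x ∈ I)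
    (hy : y ∈ I) {P Q : RPt 4} (hP : P ∈ cubeM c.M x) (hQ : Q ∈ cubeM c.M y) :
    (invTau c (S.Dk.dj Y))⁻¹ * ‖S.Q Y φ b b'‖ ≤ elem219 c (S.volk Y : ℝ) (dist P Q) := by
  have hG6 : dist P Q ≤ 4 * c.M * (S.volk Y : ℝ) := by
    rw [hvol]
    exact G6_sup (by linarith) hI hx hy hP hQ
  exact elem219_of_bound143 S c h143 h12 hC₃ hE hε hC₁ hα hM hκ₁ Y φ b b' hφ hG6

/-- **From the statement of record, ℓ¹ metric, G6 DISCHARGED** (as `elem219_of_bound143_sup`, distance Σ_i |P_i − Q_i|).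
[cite: Balaban1988RG2Cluster, (2.19) p.16, (1.43) p.11] -/
theorem elem219_of_bound143_l1 (S : B13.StepData) (c : B13.Consts) (h143 : B13.Bound143 S c) (h12 : R12 c)
    (hC₃ : 0 ≤ c.C₃) (hE : 0 < c.E₀) (hε : 0 < c.ε₁) (hC₁ : 0 < c.C₁) (hα : 0 < c.α₄) (hM : 1 ≤ c.M)
    (hκ₁ : 1 ≤ c.κ₁) (Y : S.Dk.Dom) (φ : S.Φ) (b b' : S.Bond) (hφ : φ ∈ S.sp1 Y)
    {I : Finset (Pt 4)} (hI : FaceConnected I) (hvol : S.volk Y = I.card) {x y : Pt 4} (hx : x ∈ I)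
    (hy : y ∈ I) {P Q : RPt 4} (hP : P ∈ cubeM c.M x) (hQ : Q ∈ cubeM c.M y) :
    (invTau c (S.Dk.dj Y))⁻¹ * ‖S.Q Y φ b b'‖ ≤ elem219 c (S.volk Y : ℝ) (∑ i, |P i - Q i|) := by
  have hG6 : ∑ i, |P i - Q i| ≤ 4 * c.M * (S.volk Y : ℝ) := by
    rw [hvol]
    exact G6_l1 (by linarith) hI hx hy hP hQ
  exact elem219_of_bound143 S c h143 h12 hC₃ hE hε hC₁ hα hM hκ₁ Y φ b b' hφ hG6

/-- **From the statement of record, Euclidean metric, G6 DISCHARGED** (as `elem219_of_bound143_sup`, distance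
√Σ_i (P_i − Q_i)²). [cite: Balaban1988RG2Cluster, (2.19) p.16, (1.43) p.11] -/
theorem elem219_of_bound143_l2 (S : B13.StepData) (c : B13.Consts) (h143 : B13.Bound143 S c) (h12 : R12 c)
    (hC₃ : 0 ≤ c.C₃) (hE : 0 < c.E₀) (hε : 0 < c.ε₁) (hC₁ : 0 < c.C₁) (hα : 0 < c.α₄) (hM : 1 ≤ c.M)
    (hκ₁ : 1 ≤ c.κ₁) (Y : S.Dk.Dom) (φ : S.Φ) (b b' : S.Bond) (hφ : φ ∈ S.sp1 Y)
    {I : Finset (Pt 4)} (hI : FaceConnected I) (hvol : S.volk Y = I.card) {x y : Pt 4} (hx : x ∈ I)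
    (hy : y ∈ I) {P Q : RPt 4} (hP : P ∈ cubeM c.M x) (hQ : Q ∈ cubeM c.M y) :
    (invTau c (S.Dk.dj Y))⁻¹ * ‖S.Q Y φ b b'‖ ≤ elem219 c (S.volk Y : ℝ) (Real.sqrt (∑ i, (P i - Q i) ^ 2)) := by
  have hG6 : Real.sqrt (∑ i, (P i - Q i) ^ 2) ≤ 4 * c.M * (S.volk Y : ℝ) := by
    rw [hvol]
    exact G6_l2 (by linarith) hI hx hy hP hQ
  exact elem219_of_bound143 S c h143 h12 hC₃ hE hε hC₁ hα hM hκ₁ Y φ b b' hφ hG6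

end

end Literature.MathematicalPhysics.QuantumFieldTheory.Balaban1983to89.B13DiameterG6
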